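import Summits.QuantumFields.BalabanUV.T4Continuum.Support.ShellMeasureCellGaugeFromPlaquettes
import Summits.QuantumFields.BalabanUV.T4Continuum.Support.ShellMeasureDecayRowsDirInvCells
import Summits.QuantumFields.BalabanUV.T4Continuum.Support.ShellMeasureDecayRowsLevelOpCellsSlot
import Summits.QuantumFields.BalabanUV.T4Continuum.Support.ShellMeasureDecayKernelSums
import Summits.QuantumFields.BalabanUV.Beta.MultiscaleGrowthCells

/-!
# `T4Continuum.ShellMeasureDecayRowsModelEnd` — ROW S124 = J-END «E1∕E6 FOR THE MODEL OPERATOR FROM E7 + GEOMETRY + NUMBERS»: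
# the J-lane's ONE deliverable (owner R-ne7cp1-g37-13 (b)) — for the Dirichlet-sectioned inverse of the block-sectioned MODEL operator
# `levelOp` ([B9] (3.24) SHAPE; J1 (D1)∕(D5): `levelOp = η²Δ′_a(U)`) on the slot's OWN two-level cube family, from IN-CELL
# PLAQUETTE-SMALLNESS of the background alone: (E6) the decay rows `‖k c b′‖ ≤ c𝒢·e^{−(κ·dis (pos c) (pos b′))}` for ALL cells, (RS) the
# VOLUME-FREE row sum `Σ_{b′} e^{−(κ·dis (pos c) (pos b′))} ≤ M`, (E1) `‖kerOp k‖ ≤ c𝒢·M` — every J-file consumed BY NAME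
(cell `pub-balaban`, sub-cell `t4`, spine estimate NE7c (node U5b); NE7c ROUND-2 crew `t4-ne7c-formalise-*`, unit
`b2b-balaban-t4-ne7c-formalise-leaf-02` gen 14; owner table `t4/b2b-balaban-t4-ne7c-p1/LEAVES-NE7c-P1.md` ROW **S124 = J-END** (RULING
R-ne7cp1-g37-13 (b), journal `CLAIMS.log` l.24616; MINE l.24657; binder shape l.24714); ADDITIVE — imports S119 f1
`ShellMeasureCellGaugeFromPlaquettes` (leaf-01-g12: ROW J4's gauge datum `cellGauge ∕ hgauge_of_plaquettes ∕ hloss_of_plaquettes` from in-cell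
plaquette-smallness), J3 f2 `ShellMeasureDecayRowsDirInvCells` (leaf-02-g13: the Dirichlet-sectioned E6 row; hence J3 f1), J3 f3
`ShellMeasureDecayRowsLevelOpCellsSlot` (`side_le_coarse`; hence S117 = J2 `ShellMeasureSlotCubeFamily`, leaf-06-g10: the slot's cube family and
its five geometric binders), S66 f3a `ShellMeasureDecayKernelSums`
(`kerOp`, `opNorm_kerOp_le`) and `Beta/MultiscaleGrowthCells` (beta-d4-p3 g11: the cell-count growth clause from the additive grading; over
beta-d4-p2's `Beta/MultiscaleDecayRowSums.sum_exp_neg_le_of_growth`) ONLY, everything BY NAME; touches NO host, moves NO census row;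
[folklore]; 0 `def`, 0 `def … : Prop`, 0 sorry, 0 citation tags of Bałaban's.)

HONEST FRAMING.  Finite four-torus programme, rung (B)+1 only — NOT infinite volume, NOT a mass gap, NOT the Clay problem, NOT summit
progress; (B), `BetaPertHyp`, (B^μ) not consumed and NOT discharged.  NE7c (`T4IndicatorShell.ShellWeightBound`) is NOT PRINTED in
[Balaban 1983–89] and NOT PROVED; «NE7c ⇐ the named binders» (trigger c3).

WHAT THIS IS AND IS NOT (R-ne7cp1-g37-13 (c), verbatim in substance).  It IS: E1∕E6 — the two propagator-type row shapes of THE ONE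
CALL's census (E6 `∀ c b′, ‖k V c b′‖ ≤ c·e^{−δ·dis (pos c) (pos b′)}` between cell fibres, E1 `∀ f, ‖kerOp k f‖ ≤ B₀‖f‖`) — for the
cell blocks `k` of `dirInv (levelOp) χ`, the Dirichlet compression (EVERY {0,1}-domain `χ`; `χ ≡ 1` is the full inverse) of a MODEL
operator of [B9] (3.24) SHAPE (pv21's torus `levelOp`: unit-lattice covariant Laplacian with bond weights `c_b` and column-orthonormal bond
matrices `Rm_b` + the two-level block-mean penalty `Σ_l a_l G_lᵀG_l` of J1's dictionary) on the slot's OWN geometry (S117: the blocks of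
`Λ` refined into their `L^d` sub-cubes of side `s`, every other coarse block one cell of side `L·s`), read between ℓ²-FIBRES
(`EuclideanSpace ℂ (UT N × Cp)`, J3's currency), under E7 in its LITERAL located shape «every in-cell plaquette of the background within
`α_k` of `1`, `S_k²·α_k ≤ α₀`» + numbers — a theorem of OURS.  It is NOT: E1∕E6 for Bałaban's `𝒢 = (Δ₁ + D*RD + aQ*Q)⁻¹` of
[Balaban1985Variational] (81)∕(103), nor for `H₁ = G₁𝔓*` ∕ `H`, until node O identifies the u-tuple's operators with `levelOp`-sectioned
objects (the curvature∕commutator terms of (80)–(81), the `D*RD` gauge term via S120 = J5, the Sect. D algebra via S122 = J7 ∕ S123 = J8)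
— the NEXT owner generation's junction ruling; no ONE CALL row moves; the host's letter norms are the (98) weighted-SUP pair (J1 (D9)),
so the SUP-fibre member (road P3's `Beta/MultiscaleRegularityD4`, `hreg`-free at `d = 4`) and the complex-ray twin (S121) are COMPANION
files of this row, not this file.  Nothing of Bałaban's is instantiated, asserted, cited or discharged; census COUNT unchanged.
HONEST DEPENDENCY (cell): continuum YM on T⁴ ⇐ BetaPertH ∧ nine spine estimates (0/9 proved); BetaPertH ⇐ (D1) ∧ (D4) ∧ CAP+tail;
G-an2-4 gates asym, D1 and NE2/3/4.

CONTENT (kernel).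
* §1 **(E6) `decayRow_dirInv_slot_of_plaquettes`** = J3 f2 `decayRow_dirInv_cells` FIRED BY NAME on S117's family (`cells_disjoint
  cells_cover meanProfile_supp scale_lo scale_hi`, contour transports, `S_max := L·s` SUPPLIED) with its cell-sum coercivity SUPPLIED by
  `Beta/MultiscaleCoerciveTorusCov.multiscale_coercive_torus_cov` at S119 f1's designed gauge (`cellGauge cellGauge_orth hgauge_of_plaquettes
  hloss_of_plaquettes`, `θ := 8d⁴α₀²`) — token for token leaf-01-g12's generic junction S119 f3 `decayRow_dirInv_cells_of_plaquettes`
  (p244060), specialised to the slot family (S119 f3 is NOT imported only because its olean was unavailable on the farm at filing time): for every {0,1}-domain `χ` and ALL cells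
  `c b′ : Cell s L Λ`, `‖blockχ c b′‖ ≤ (e^{4dκ}(L·s)²∕min(μ₀,1))·exp(−(κ·sdist (corner c) (corner b′)))`,
  `μ₀ = (1 − 8d⁴α₀²)·min(c_min²∕(4d), a_min∕4) − 2d·c_max²κ² − a_max(e^{2dκ} − 1)`.  DISPLAYED: `hRm`, `0 < c_min ≤ |c_b| ≤ c_max`,
  `0 ≤ a_min ≤ α_l ≤ a_max`, the E7 letters `α hα hαS hplaq`, `κ ∈ [0,1]`, `hμ`, `χ hχ` — NO geometric binder.
* §2 **(RS) THE ROW SUM IS VOLUME-FREE**: the slot family is ADDITIVELY GRADED with `A = 1` (`scaleExp_spec`: site scale `L^j` on the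
  slot, `L^{j+1}` off it, for graded sizes `s = L^j`; `grading_add`); hence `MultiscaleGrowthCells.cell_growth_add` counts
  `#{b′ : sdist (corner c) (corner b′) < m} ≤ N₀Λ^m` (`Λ = e^{ε + 2(log L∕R)d}`, `N₀ = (3(L¹)²)^d(d!∕ε^d)e^{2d(ε + (log L∕R)d)}`, any
  `ε, R > 0`) and `MultiscaleDecayRowSums.sum_exp_neg_le_of_growth` sums: **`rowSum_sdist_slot`**
  `Σ_{b′} exp(−(κ·sdist (corner c) (corner b′))) ≤ N₀Λ∕(1 − Λe^{−κ})` under the rate condition `Λe^{−κ} < 1` — NO volume, NO `N`, NO `#Λ`.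
* §3 **(E1) `opNorm_kerOp_dirInv_slot_of_plaquettes`**: `‖kerOp blockχ‖ ≤ (e^{4dκ}(L·s)²∕min(μ₀,1))·N₀Λ∕(1 − Λe^{−κ})` — S66 f3a
  `opNorm_kerOp_le` BY NAME over §1 + §2 (`kerOp` on `Cell s L Λ → EuclideanSpace ℂ (UT N × Cp)` with the sup-over-cells norm: the
  host's letter operator shape); **`norm_kerOp_dirInv_slot_apply_le`**: the host's POINTWISE `h𝒢w` shape `∀ f, ‖kerOp blockχ f‖ ≤ B₀·‖f‖`
  (one `le_opNorm` line; leaf-06-g10's pre-read INFO-1).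
  NORMALISATION (leaf-06-g10's INFO-2, for node O): the constants carry the entry END's LOCAL PREFACTOR `(L·s)²` (`n(p)n(q) ≤ S_max²`);
  at the designed sizes `s = L^j` this is `L^{2j+2}` — level-DEPENDENT for the raw `dirInv (levelOp)`, level-FREE exactly for the
  `η_j²`-normalised inverse of J1 (D2)∕(D5) (`η_j²·(L·s)² = L²` at `η_j = L^{−j}`); which normalisation the host's `k𝒢` letter carries is
  node O's identification, not decided here.
* §4 RULE G-1: the numbers are jointly inhabited at `d = 4` (`mu0_pos_d4`, `rate_d4`) and the three ENDs FIRE on the `d = 4` slot family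
  (torus `4⁴`, `s = 1 = 2⁰`, `L = 2`, ANY slot, fibre `Unit`, `c ≡ 1`, level coefficients `≡ 1`, `κ = 10⁻³`, `ε = 10⁻⁴`, `R = 10⁵`)
  at the FLAT background `Rm ≡ 1` — whose in-cell plaquettes ARE `1` (`cellPlaq_flat`, E7 with `α ≡ 0`) — with EVERY hypothesis
  discharged.  A CONSISTENCY witness of the hypothesis list, not a size claim: at these numbers `N₀ ≈ 5·10²¹` (not sharp).
-/

noncomputable section

open scoped BigOperators Matrix Matrix.Norms.L2Operator
open Finset Function

namespace Summit.QuantumFields.BalabanUV.T4Continuum.ShellMeasureDecayRowsModelEnd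

open Summit.QuantumFields.BalabanUV.Beta
open Summit.QuantumFields.BalabanUV.Beta.BoxPoincare (Box)
open Summit.QuantumFields.BalabanUV.Beta.CovariantBoxPoincare (hol succ)
open Summit.QuantumFields.BalabanUV.Beta.MultiscaleCoerciveTorus
open Summit.QuantumFields.BalabanUV.Beta.MultiscaleDecayBudget (siteScale cellOf)
open Summit.QuantumFields.BalabanUV.Beta.MultiscaleDistance (sdist sdist_nonneg)
open Summit.QuantumFields.BalabanUV.Beta.MultiscaleGrowthCells (cell_growth_add)
open Summit.QuantumFields.BalabanUV.Beta.MultiscaleDecayRowSums (sum_exp_neg_le_of_growth)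
open Summit.QuantumFields.BalabanUV.Beta.ThinLoopHolonomy (cpxHom)
open Summit.QuantumFields.BalabanUV.T4Continuum.ShellMeasureSlotCubeFamily
open Summit.QuantumFields.BalabanUV.T4Continuum.ShellMeasureDecayRowsLevelOpCellsSlot (side_le_coarse)
open Summit.QuantumFields.BalabanUV.T4Continuum.ShellMeasureCellGaugeFromPlaquettes
  (cellPlaq cellGauge cellGauge_orth hgauge_of_plaquettes hloss_of_plaquettes)
open Summit.QuantumFields.BalabanUV.T4Continuum.ShellMeasureDecayRowsDirInvCells (decayRow_dirInv_cells)
open Summit.QuantumFields.BalabanUV.Beta.MultiscaleCoerciveTorusCov (multiscale_coercive_torus_cov)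
open Summit.QuantumFields.BalabanUV.T4Continuum.ShellMeasureDecayKernelSums (kerOp opNorm_kerOp_le)
open Literature.MathematicalPhysics.QuantumFieldTheory.Balaban1983to89
open Literature.MathematicalPhysics.QuantumFieldTheory.Balaban1983to89.B9Thm37GluePU (bsrc btgt)
open Literature.MathematicalPhysics.QuantumFieldTheory.Balaban1983to89.B9Thm37GlueTorusCov (tblk torusComb)
open Literature.MathematicalPhysics.QuantumFieldTheory.Balaban1983to89.B9Thm37GlueTorusCovLevels (levelOp)
open Literature.MathematicalPhysics.QuantumFieldTheory.Balaban1983to89.B9Thm37GlueTorusInv (dirInv)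
open B5TorusCover (UT Ctr ctrU nC)

variable {d : ℕ} [NeZero d] {N : Fin d → ℕ} [∀ i, NeZero (N i)] {Cp : Type} [Fintype Cp] [DecidableEq Cp] [Nonempty Cp]
variable {s L : ℕ} {Λ : Finset (Ctr N (L * s))} (hs : 1 ≤ s) (hL : 1 ≤ L) (hdiv : ∀ i, L * s ∣ N i)

/-! ## §1 (E6): the Dirichlet-sectioned decay rows on the slot family from in-cell plaquette-smallness -/

/-- **(E6) ON THE SLOT's OWN GEOMETRY, FROM E7's LITERAL SHAPE** (J3 f2 `decayRow_dirInv_cells` BY NAME with S117's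
`cells_disjoint cells_cover meanProfile_supp scale_lo scale_hi`, `S_max := L·s`, and the coercivity from `multiscale_coercive_torus_cov` at
S119 f1's `cellGauge ∕ hgauge_of_plaquettes ∕ hloss_of_plaquettes` SUPPLIED — leaf-01-g12's S119 f3 composition, on the slot): for column-orthonormal bond matrices `Rm`,
bond weights `0 < c_min ≤ |c_b| ≤ c_max`, level coefficients `0 ≤ a_min ≤ α_l ≤ a_max`, in-cell plaquette sizes `α_k ≥ 0` with
`S_k²·α_k ≤ α₀` and `‖plaquette − 1‖ ≤ α_k`, a rate `κ ∈ [0,1]` with `μ₀ > 0`, every {0,1}-domain `χ` and ALL cells `c b′` of the slot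
family: `‖blockχ c b′‖ ≤ (e^{4dκ}(L·s)²∕min(μ₀,1))·exp(−(κ·sdist (corner c) (corner b′)))`. [folklore] -/
theorem decayRow_dirInv_slot_of_plaquettes
    (Rm : UT N × Fin d → Cp → Cp → ℝ) (hRm : ∀ b i j, ∑ k, Rm b k i * Rm b k j = if i = j then (1 : ℝ) else 0)
    {acoef : Bool → ℝ} {amin amax : ℝ} (hamin : 0 ≤ amin) (ha_lo : ∀ l, amin ≤ acoef l) (ha_hi : ∀ l, acoef l ≤ amax)
    (c : UT N × Fin d → ℝ) {cmin cmax : ℝ} (hcmin : 0 < cmin) (hc_lo : ∀ b, cmin ≤ |c b|) (hc_hi : ∀ b, |c b| ≤ cmax)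
    (α : Cell s L Λ → ℝ) (hα : ∀ k, 0 ≤ α k) {α₀ : ℝ} (hαS : ∀ k, (side s L (lvl k) : ℝ) ^ 2 * α k ≤ α₀)
    (hplaq : ∀ (k : Cell s L Λ) (v : Box d (side s L (lvl k))) (κ μ : Fin d) (hκ : (v κ : ℕ) + 1 < side s L (lvl k))
      (hμ : (v μ : ℕ) + 1 < side s L (lvl k)), κ ≠ μ →
        ‖cpxHom (cellPlaq (side s L) (side_pos hs hL) (side_dvd hdiv) lvl (zc hs hL hdiv) Rm k v κ μ hκ hμ) - 1‖ ≤ α k)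
    {κ : ℝ} (hκ0 : 0 ≤ κ) (hκ1 : κ ≤ 1)
    (hμ : 0 < (1 - 8 * (d : ℝ) ^ 4 * α₀ ^ 2) * min (cmin ^ 2 / (4 * d)) (amin / 4) - 2 * d * cmax ^ 2 * κ ^ 2 -
      amax * (Real.exp (2 * d * κ) - 1))
    (χ : UT N × Cp → ℝ) (hχ : ∀ p, χ p = 0 ∨ χ p = 1) (cc b' : Cell s L Λ) :
    ‖Matrix.toEuclideanCLM (n := UT N × Cp) (𝕜 := ℂ)
        ((Matrix.of fun p q : UT N × Cp =>
          if cellOf (side s L) (side_pos hs hL) (side_dvd hdiv) lvl (zc hs hL hdiv) (cells_cover (Λ := Λ) hs hL hdiv) p.1 = cc ∧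
              cellOf (side s L) (side_pos hs hL) (side_dvd hdiv) lvl (zc hs hL hdiv) (cells_cover (Λ := Λ) hs hL hdiv) q.1 = b' then
            (dirInv (levelOp bsrc btgt c Rm (fun l x => ctrU N (side s L l) (tblk (side_pos hs hL l) (side_dvd hdiv l) x))
              (fun l x => meanProfile hs hL hdiv Λ l (ctrU N (side s L l) (tblk (side_pos hs hL l) (side_dvd hdiv l) x)))
              (fun l x => (torusComb (side_pos hs hL l) (side_dvd hdiv l)).tr Rm x) (treeWeight d s L acoef)) χ)
              (Pi.single q 1) p
          else 0).map Complex.ofReal)‖ ≤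
      (Real.exp (4 * d * κ) * ((L * s : ℕ) : ℝ) ^ 2 /
          min ((1 - 8 * (d : ℝ) ^ 4 * α₀ ^ 2) * min (cmin ^ 2 / (4 * d)) (amin / 4) - 2 * d * cmax ^ 2 * κ ^ 2 -
            amax * (Real.exp (2 * d * κ) - 1)) 1) *
        Real.exp (-(κ * sdist bsrc btgt
          (siteScale (side s L) (side_pos hs hL) (side_dvd hdiv) lvl (zc hs hL hdiv) (cells_cover (Λ := Λ) hs hL hdiv))
          (ctrU N (side s L (lvl cc)) (zc hs hL hdiv cc)) (ctrU N (side s L (lvl b')) (zc hs hL hdiv b')))) :=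
  decayRow_dirInv_cells (side s L) (side_pos hs hL) (side_dvd hdiv) lvl (zc hs hL hdiv) (cells_disjoint hs hL hdiv) (cells_cover hs hL hdiv)
    Rm hRm (fun l x => (torusComb (side_pos hs hL l) (side_dvd hdiv l)).tr Rm x)
    (fun l x i i' => (torusComb (side_pos hs hL l) (side_dvd hdiv l)).tr_orth Rm hRm x i i') (treeWeight d s L acoef)
    (treeWeight_nonneg fun l => hamin.trans (ha_lo l)) (meanProfile hs hL hdiv Λ) (meanProfile_supp hs hL hdiv)
    (hamin.trans ((ha_lo true).trans (ha_hi true))) (scale_hi hs hL hdiv ha_hi) c hc_hi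
    (fun f => multiscale_coercive_torus_cov (Nat.one_le_iff_ne_zero.mpr (NeZero.ne d)) (side s L) (side_pos hs hL) (side_dvd hdiv)
      Rm hRm (treeWeight d s L acoef) (treeWeight_nonneg fun l => hamin.trans (ha_lo l)) (meanProfile hs hL hdiv Λ) c hcmin hc_lo
      lvl (zc hs hL hdiv) (cells_disjoint hs hL hdiv) hamin (scale_lo hs hL hdiv ha_lo)
      (cellGauge (side s L) (side_pos hs hL) (side_dvd hdiv) lvl (zc hs hL hdiv) Rm hRm)
      (cellGauge_orth (side s L) (side_pos hs hL) (side_dvd hdiv) lvl (zc hs hL hdiv) Rm hRm)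
      (fun k => d * ((side s L (lvl k) : ℝ) - 1) * α k)
      (fun k => by
        have hs1 : (1 : ℝ) ≤ side s L (lvl k) := by exact_mod_cast side_pos hs hL (lvl k)
        have := hα k
        have : (0 : ℝ) ≤ (side s L (lvl k) : ℝ) - 1 := by linarith
        positivity)
      (fun k v i hv u => hgauge_of_plaquettes (side s L) (side_pos hs hL) (side_dvd hdiv) lvl (zc hs hL hdiv) Rm hRm k (hα k)
        (hplaq k) v i hv u)
      (fun k => hloss_of_plaquettes (side s L) (side_pos hs hL) lvl α hα hαS k) f)
    hκ0 hκ1 hμ χ hχ (fun k => side_le_coarse hL (lvl k)) cc b'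

/-! ## §2 (RS): the slot family is additively graded with `A = 1`; the row sum is volume-free -/

omit [NeZero d] in
/-- **THE SITE SCALE OF THE SLOT FAMILY IS `L^{e(x)}`** with the scale exponent `e x = j` on the slot and `j + 1` off it, for graded sizes
`s = L^j` (S117 `siteScale_eq`). [folklore] -/
theorem scaleExp_spec {j : ℕ} (hsj : s = L ^ j) (x : UT N) :
    siteScale (side s L) (side_pos hs hL) (side_dvd hdiv) lvl (zc hs hL hdiv) (cells_cover (Λ := Λ) hs hL hdiv) x =
      L ^ (if tblk (one_le_coarse hs hL) hdiv x ∈ Λ then j else j + 1) := by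
  rw [siteScale_eq hs hL hdiv x]
  split_ifs
  · exact hsj
  · rw [pow_succ, hsj, mul_comm]

omit [NeZero d] in
/-- **THE ADDITIVE GRADING OF THE SLOT FAMILY, `A = 1`**: the scale exponents of any two sites differ by at most `1 ≤ 1 + sdist∕R`.
[folklore] -/
theorem grading_add {j : ℕ} {R : ℝ} (hR : 0 < R) (x y : UT N) :
    |(((if tblk (one_le_coarse hs hL) hdiv x ∈ Λ then j else j + 1 : ℕ) : ℝ)) -
        ((if tblk (one_le_coarse hs hL) hdiv y ∈ Λ then j else j + 1 : ℕ) : ℝ)| ≤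
      (1 : ℕ) + sdist bsrc btgt
        (siteScale (side s L) (side_pos hs hL) (side_dvd hdiv) lvl (zc hs hL hdiv) (cells_cover (Λ := Λ) hs hL hdiv)) x y / R := by
  have hsd : 0 ≤ sdist bsrc btgt
      (siteScale (side s L) (side_pos hs hL) (side_dvd hdiv) lvl (zc hs hL hdiv) (cells_cover (Λ := Λ) hs hL hdiv)) x y / R :=
    div_nonneg (sdist_nonneg _ _ _ x y) hR.le
  have h1 : |(((if tblk (one_le_coarse hs hL) hdiv x ∈ Λ then j else j + 1 : ℕ) : ℝ)) -
      ((if tblk (one_le_coarse hs hL) hdiv y ∈ Λ then j else j + 1 : ℕ) : ℝ)| ≤ 1 := by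
    split_ifs <;> push_cast <;> norm_num
  calc _ ≤ (1 : ℝ) := h1
    _ ≤ (1 : ℕ) + _ := by rw [Nat.cast_one]; linarith

/-- **(RS) THE ROW SUM OVER THE SLOT FAMILY IS VOLUME-FREE** (`MultiscaleGrowthCells.cell_growth_add` with the grading of `scaleExp_spec`∕
`grading_add`, then `MultiscaleDecayRowSums.sum_exp_neg_le_of_growth`, BY NAME): for graded sizes `s = L^j`, any `ε > 0`, `R > 0` and a
rate `κ ≥ 0` with `Λ·e^{−κ} < 1`, `Λ := e^{ε + 2(log L∕R)d}`: for EVERY cell `c`,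
`Σ_{b′} exp(−(κ·sdist (corner c) (corner b′))) ≤ N₀Λ∕(1 − Λe^{−κ})`, `N₀ = (3(L¹)²)^d·(d!∕ε^d)·e^{2d(ε + (log L∕R)d)}` — no volume, no `N`,
no `#Λ`, no level count. [folklore] -/
theorem rowSum_sdist_slot {j : ℕ} (hsj : s = L ^ j) {ε R κ : ℝ} (hε : 0 < ε) (hR : 0 < R) (hκ0 : 0 ≤ κ)
    (hq : Real.exp (ε + 2 * (Real.log L / R) * d) * Real.exp (-κ) < 1) (cc : Cell s L Λ) :
    ∑ b' : Cell s L Λ, Real.exp (-(κ * sdist bsrc btgt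
        (siteScale (side s L) (side_pos hs hL) (side_dvd hdiv) lvl (zc hs hL hdiv) (cells_cover (Λ := Λ) hs hL hdiv))
        (ctrU N (side s L (lvl cc)) (zc hs hL hdiv cc)) (ctrU N (side s L (lvl b')) (zc hs hL hdiv b')))) ≤
      (3 * ((L : ℝ) ^ (1 : ℕ)) ^ 2) ^ d * ((d.factorial : ℝ) / ε ^ d) * Real.exp (2 * d * (ε + Real.log L / R * d)) *
          Real.exp (ε + 2 * (Real.log L / R) * d) /
        (1 - Real.exp (ε + 2 * (Real.log L / R) * d) * Real.exp (-κ)) :=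
  sum_exp_neg_le_of_growth
    (fun b' : Cell s L Λ => sdist bsrc btgt
      (siteScale (side s L) (side_pos hs hL) (side_dvd hdiv) lvl (zc hs hL hdiv) (cells_cover (Λ := Λ) hs hL hdiv))
      (ctrU N (side s L (lvl cc)) (zc hs hL hdiv cc)) (ctrU N (side s L (lvl b')) (zc hs hL hdiv b')))
    (fun b' => sdist_nonneg _ _ _ _ _) (by positivity) (Real.exp_pos _).le
    (fun m => cell_growth_add (side s L) (side_pos hs hL) (side_dvd hdiv) lvl (zc hs hL hdiv) (cells_disjoint hs hL hdiv)
      (cells_cover hs hL hdiv) hL (fun x => if tblk (one_le_coarse hs hL) hdiv x ∈ Λ then j else j + 1)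
      (scaleExp_spec hs hL hdiv hsj) hR (A := 1) (grading_add hs hL hdiv hR) hε cc m)
    hκ0 hq

/-! ## §3 (E1): the kernel operator of the cell blocks is bounded, volume-free -/

/-- **(E1) FROM (E6) + (RS)** (S66 f3a `opNorm_kerOp_le` BY NAME): under the hypotheses of §1 and §2, the kernel operator of the cell
blocks of `dirInv (levelOp) χ` on bond fields `Cell s L Λ → EuclideanSpace ℂ (UT N × Cp)` (sup-over-cells norm) has
`‖kerOp blockχ‖ ≤ (e^{4dκ}(L·s)²∕min(μ₀,1))·N₀Λ∕(1 − Λe^{−κ})` — the E1-type row of THE ONE CALL for the MODEL operator, its constant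
`B₀` built from `d, L, s, c_min, c_max, a_min, a_max, α₀, κ, ε, R` ONLY. [folklore] -/
theorem opNorm_kerOp_dirInv_slot_of_plaquettes {j : ℕ} (hsj : s = L ^ j)
    (Rm : UT N × Fin d → Cp → Cp → ℝ) (hRm : ∀ b i j, ∑ k, Rm b k i * Rm b k j = if i = j then (1 : ℝ) else 0)
    {acoef : Bool → ℝ} {amin amax : ℝ} (hamin : 0 ≤ amin) (ha_lo : ∀ l, amin ≤ acoef l) (ha_hi : ∀ l, acoef l ≤ amax)
    (c : UT N × Fin d → ℝ) {cmin cmax : ℝ} (hcmin : 0 < cmin) (hc_lo : ∀ b, cmin ≤ |c b|) (hc_hi : ∀ b, |c b| ≤ cmax)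
    (α : Cell s L Λ → ℝ) (hα : ∀ k, 0 ≤ α k) {α₀ : ℝ} (hαS : ∀ k, (side s L (lvl k) : ℝ) ^ 2 * α k ≤ α₀)
    (hplaq : ∀ (k : Cell s L Λ) (v : Box d (side s L (lvl k))) (κ μ : Fin d) (hκ : (v κ : ℕ) + 1 < side s L (lvl k))
      (hμ : (v μ : ℕ) + 1 < side s L (lvl k)), κ ≠ μ →
        ‖cpxHom (cellPlaq (side s L) (side_pos hs hL) (side_dvd hdiv) lvl (zc hs hL hdiv) Rm k v κ μ hκ hμ) - 1‖ ≤ α k)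
    {κ : ℝ} (hκ0 : 0 ≤ κ) (hκ1 : κ ≤ 1)
    (hμ : 0 < (1 - 8 * (d : ℝ) ^ 4 * α₀ ^ 2) * min (cmin ^ 2 / (4 * d)) (amin / 4) - 2 * d * cmax ^ 2 * κ ^ 2 -
      amax * (Real.exp (2 * d * κ) - 1))
    {ε R : ℝ} (hε : 0 < ε) (hR : 0 < R) (hq : Real.exp (ε + 2 * (Real.log L / R) * d) * Real.exp (-κ) < 1)
    (χ : UT N × Cp → ℝ) (hχ : ∀ p, χ p = 0 ∨ χ p = 1) :
    ‖kerOp (𝕜 := ℂ) (fun cc b' : Cell s L Λ => Matrix.toEuclideanCLM (n := UT N × Cp) (𝕜 := ℂ)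
        ((Matrix.of fun p q : UT N × Cp =>
          if cellOf (side s L) (side_pos hs hL) (side_dvd hdiv) lvl (zc hs hL hdiv) (cells_cover (Λ := Λ) hs hL hdiv) p.1 = cc ∧
              cellOf (side s L) (side_pos hs hL) (side_dvd hdiv) lvl (zc hs hL hdiv) (cells_cover (Λ := Λ) hs hL hdiv) q.1 = b' then
            (dirInv (levelOp bsrc btgt c Rm (fun l x => ctrU N (side s L l) (tblk (side_pos hs hL l) (side_dvd hdiv l) x))
              (fun l x => meanProfile hs hL hdiv Λ l (ctrU N (side s L l) (tblk (side_pos hs hL l) (side_dvd hdiv l) x)))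
              (fun l x => (torusComb (side_pos hs hL l) (side_dvd hdiv l)).tr Rm x) (treeWeight d s L acoef)) χ)
              (Pi.single q 1) p
          else 0).map Complex.ofReal))‖ ≤
      Real.exp (4 * d * κ) * ((L * s : ℕ) : ℝ) ^ 2 /
          min ((1 - 8 * (d : ℝ) ^ 4 * α₀ ^ 2) * min (cmin ^ 2 / (4 * d)) (amin / 4) - 2 * d * cmax ^ 2 * κ ^ 2 -
            amax * (Real.exp (2 * d * κ) - 1)) 1 *
        ((3 * ((L : ℝ) ^ (1 : ℕ)) ^ 2) ^ d * ((d.factorial : ℝ) / ε ^ d) * Real.exp (2 * d * (ε + Real.log L / R * d)) *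
            Real.exp (ε + 2 * (Real.log L / R) * d) /
          (1 - Real.exp (ε + 2 * (Real.log L / R) * d) * Real.exp (-κ))) := by
  have hμ1 : 0 < min ((1 - 8 * (d : ℝ) ^ 4 * α₀ ^ 2) * min (cmin ^ 2 / (4 * d)) (amin / 4) - 2 * d * cmax ^ 2 * κ ^ 2 -
      amax * (Real.exp (2 * d * κ) - 1)) 1 := lt_min hμ one_pos
  have hC : 0 ≤ Real.exp (4 * d * κ) * ((L * s : ℕ) : ℝ) ^ 2 /
      min ((1 - 8 * (d : ℝ) ^ 4 * α₀ ^ 2) * min (cmin ^ 2 / (4 * d)) (amin / 4) - 2 * d * cmax ^ 2 * κ ^ 2 -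
        amax * (Real.exp (2 * d * κ) - 1)) 1 := by positivity
  have hq1 : 0 < 1 - Real.exp (ε + 2 * (Real.log L / R) * d) * Real.exp (-κ) := by linarith
  have hM : 0 ≤ (3 * ((L : ℝ) ^ (1 : ℕ)) ^ 2) ^ d * ((d.factorial : ℝ) / ε ^ d) * Real.exp (2 * d * (ε + Real.log L / R * d)) *
      Real.exp (ε + 2 * (Real.log L / R) * d) / (1 - Real.exp (ε + 2 * (Real.log L / R) * d) * Real.exp (-κ)) := by positivity
  refine opNorm_kerOp_le _ (mul_nonneg hC hM) fun cc => ?_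
  calc _ ≤ ∑ b' : Cell s L Λ, Real.exp (4 * d * κ) * ((L * s : ℕ) : ℝ) ^ 2 /
            min ((1 - 8 * (d : ℝ) ^ 4 * α₀ ^ 2) * min (cmin ^ 2 / (4 * d)) (amin / 4) - 2 * d * cmax ^ 2 * κ ^ 2 -
              amax * (Real.exp (2 * d * κ) - 1)) 1 *
          Real.exp (-(κ * sdist bsrc btgt
            (siteScale (side s L) (side_pos hs hL) (side_dvd hdiv) lvl (zc hs hL hdiv) (cells_cover (Λ := Λ) hs hL hdiv))
            (ctrU N (side s L (lvl cc)) (zc hs hL hdiv cc)) (ctrU N (side s L (lvl b')) (zc hs hL hdiv b')))) :=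
        Finset.sum_le_sum fun b' _ => decayRow_dirInv_slot_of_plaquettes hs hL hdiv Rm hRm hamin ha_lo ha_hi c hcmin hc_lo hc_hi
          α hα hαS hplaq hκ0 hκ1 hμ χ hχ cc b'
    _ = Real.exp (4 * d * κ) * ((L * s : ℕ) : ℝ) ^ 2 /
            min ((1 - 8 * (d : ℝ) ^ 4 * α₀ ^ 2) * min (cmin ^ 2 / (4 * d)) (amin / 4) - 2 * d * cmax ^ 2 * κ ^ 2 -
              amax * (Real.exp (2 * d * κ) - 1)) 1 *
          ∑ b' : Cell s L Λ, Real.exp (-(κ * sdist bsrc btgt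
            (siteScale (side s L) (side_pos hs hL) (side_dvd hdiv) lvl (zc hs hL hdiv) (cells_cover (Λ := Λ) hs hL hdiv))
            (ctrU N (side s L (lvl cc)) (zc hs hL hdiv cc)) (ctrU N (side s L (lvl b')) (zc hs hL hdiv b')))) := by
        rw [Finset.mul_sum]
    _ ≤ _ := mul_le_mul_of_nonneg_left (rowSum_sdist_slot hs hL hdiv hsj hε hR hκ0 hq cc) hC

/-- **(E1) POINTWISE — THE HOST's `h𝒢w` SHAPE `∀ f, ‖kerOp k f‖ ≤ B₀·‖f‖`** (one `le_opNorm` line over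
`opNorm_kerOp_dirInv_slot_of_plaquettes`; `B₀ := (e^{4dκ}(L·s)²∕min(μ₀,1))·N₀Λ∕(1 − Λe^{−κ})`). [folklore] -/
theorem norm_kerOp_dirInv_slot_apply_le {j : ℕ} (hsj : s = L ^ j)
    (Rm : UT N × Fin d → Cp → Cp → ℝ) (hRm : ∀ b i j, ∑ k, Rm b k i * Rm b k j = if i = j then (1 : ℝ) else 0)
    {acoef : Bool → ℝ} {amin amax : ℝ} (hamin : 0 ≤ amin) (ha_lo : ∀ l, amin ≤ acoef l) (ha_hi : ∀ l, acoef l ≤ amax)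
    (c : UT N × Fin d → ℝ) {cmin cmax : ℝ} (hcmin : 0 < cmin) (hc_lo : ∀ b, cmin ≤ |c b|) (hc_hi : ∀ b, |c b| ≤ cmax)
    (α : Cell s L Λ → ℝ) (hα : ∀ k, 0 ≤ α k) {α₀ : ℝ} (hαS : ∀ k, (side s L (lvl k) : ℝ) ^ 2 * α k ≤ α₀)
    (hplaq : ∀ (k : Cell s L Λ) (v : Box d (side s L (lvl k))) (κ μ : Fin d) (hκ : (v κ : ℕ) + 1 < side s L (lvl k))
      (hμ : (v μ : ℕ) + 1 < side s L (lvl k)), κ ≠ μ →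
        ‖cpxHom (cellPlaq (side s L) (side_pos hs hL) (side_dvd hdiv) lvl (zc hs hL hdiv) Rm k v κ μ hκ hμ) - 1‖ ≤ α k)
    {κ : ℝ} (hκ0 : 0 ≤ κ) (hκ1 : κ ≤ 1)
    (hμ : 0 < (1 - 8 * (d : ℝ) ^ 4 * α₀ ^ 2) * min (cmin ^ 2 / (4 * d)) (amin / 4) - 2 * d * cmax ^ 2 * κ ^ 2 -
      amax * (Real.exp (2 * d * κ) - 1))
    {ε R : ℝ} (hε : 0 < ε) (hR : 0 < R) (hq : Real.exp (ε + 2 * (Real.log L / R) * d) * Real.exp (-κ) < 1)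
    (χ : UT N × Cp → ℝ) (hχ : ∀ p, χ p = 0 ∨ χ p = 1) (f : Cell s L Λ → EuclideanSpace ℂ (UT N × Cp)) :
    ‖kerOp (𝕜 := ℂ) (fun cc b' : Cell s L Λ => Matrix.toEuclideanCLM (n := UT N × Cp) (𝕜 := ℂ)
        ((Matrix.of fun p q : UT N × Cp =>
          if cellOf (side s L) (side_pos hs hL) (side_dvd hdiv) lvl (zc hs hL hdiv) (cells_cover (Λ := Λ) hs hL hdiv) p.1 = cc ∧
              cellOf (side s L) (side_pos hs hL) (side_dvd hdiv) lvl (zc hs hL hdiv) (cells_cover (Λ := Λ) hs hL hdiv) q.1 = b' then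
            (dirInv (levelOp bsrc btgt c Rm (fun l x => ctrU N (side s L l) (tblk (side_pos hs hL l) (side_dvd hdiv l) x))
              (fun l x => meanProfile hs hL hdiv Λ l (ctrU N (side s L l) (tblk (side_pos hs hL l) (side_dvd hdiv l) x)))
              (fun l x => (torusComb (side_pos hs hL l) (side_dvd hdiv l)).tr Rm x) (treeWeight d s L acoef)) χ)
              (Pi.single q 1) p
          else 0).map Complex.ofReal)) f‖ ≤
      Real.exp (4 * d * κ) * ((L * s : ℕ) : ℝ) ^ 2 /
          min ((1 - 8 * (d : ℝ) ^ 4 * α₀ ^ 2) * min (cmin ^ 2 / (4 * d)) (amin / 4) - 2 * d * cmax ^ 2 * κ ^ 2 -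
            amax * (Real.exp (2 * d * κ) - 1)) 1 *
        ((3 * ((L : ℝ) ^ (1 : ℕ)) ^ 2) ^ d * ((d.factorial : ℝ) / ε ^ d) * Real.exp (2 * d * (ε + Real.log L / R * d)) *
            Real.exp (ε + 2 * (Real.log L / R) * d) /
          (1 - Real.exp (ε + 2 * (Real.log L / R) * d) * Real.exp (-κ))) * ‖f‖ :=
  (ContinuousLinearMap.le_opNorm _ f).trans (mul_le_mul_of_nonneg_right
    (opNorm_kerOp_dirInv_slot_of_plaquettes hs hL hdiv hsj Rm hRm hamin ha_lo ha_hi c hcmin hc_lo hc_hi α hα hαS hplaq hκ0 hκ1 hμ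
      hε hR hq χ hχ) (norm_nonneg f))

/-! ## §4 RULE G-1: the numbers are inhabited at `d = 4` and the three ENDs fire at the flat background -/

omit [NeZero d] [Nonempty Cp] in
/-- the in-cell plaquettes of the FLAT background `Rm ≡ 1` are `1`: E7's letter is inhabited with `α ≡ 0`. [folklore] -/
theorem cellPlaq_flat {S : Bool → ℕ} {hS : ∀ l, 1 ≤ S l} {hdivS : ∀ l i, S l ∣ N i} {zc' : (k : Cell s L Λ) → Ctr N (S (lvl k))}
    (k : Cell s L Λ) (v : Box d (S (lvl k))) (κ μ : Fin d) (hκ : (v κ : ℕ) + 1 < S (lvl k)) (hμ : (v μ : ℕ) + 1 < S (lvl k)) :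
    cellPlaq S hS hdivS lvl zc' (fun _ => (oneM : Cp → Cp → ℝ)) k v κ μ hκ hμ = 1 := by
  have h1 : Matrix.of (oneM : Cp → Cp → ℝ) = 1 := by
    ext i j
    simp only [Matrix.of_apply, oneM, Matrix.one_apply]
  simp only [cellPlaq, h1, Matrix.transpose_one, Matrix.mul_one]

omit [NeZero d] [Nonempty Cp] in
/-- … hence `‖cpxHom (plaquette) − 1‖ = 0 ≤ 0` at the flat background. [folklore] -/
theorem norm_cellPlaq_flat_sub_one {S : Bool → ℕ} {hS : ∀ l, 1 ≤ S l} {hdivS : ∀ l i, S l ∣ N i}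
    {zc' : (k : Cell s L Λ) → Ctr N (S (lvl k))}
    (k : Cell s L Λ) (v : Box d (S (lvl k))) (κ μ : Fin d) (hκ : (v κ : ℕ) + 1 < S (lvl k)) (hμ : (v μ : ℕ) + 1 < S (lvl k)) :
    ‖cpxHom (cellPlaq S hS hdivS lvl zc' (fun _ => (oneM : Cp → Cp → ℝ)) k v κ μ hκ hμ) - 1‖ ≤ (0 : ℝ) := by
  rw [cellPlaq_flat, map_one, sub_self, norm_zero]

/-- THE NUMBERS AT `d = 4` (i): `μ₀ > 0` for `c ≡ 1`, level coefficients `≡ 1`, `α₀ = 0`, `κ = 10⁻³` (`|e^x − 1 − x| ≤ x²` for `|x| ≤ 1`).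
[folklore] -/
theorem mu0_pos_d4 : 0 < (1 - 8 * ((4 : ℕ) : ℝ) ^ 4 * (0 : ℝ) ^ 2) * min ((1 : ℝ) ^ 2 / (4 * ((4 : ℕ) : ℝ))) ((1 : ℝ) / 4) -
    2 * ((4 : ℕ) : ℝ) * (1 : ℝ) ^ 2 * (1 / 1000) ^ 2 - 1 * (Real.exp (2 * ((4 : ℕ) : ℝ) * (1 / 1000)) - 1) := by
  have hx : |(2 * ((4 : ℕ) : ℝ) * (1 / 1000))| ≤ 1 := by norm_num [abs_of_nonneg]
  have h := Real.abs_exp_sub_one_sub_id_le hx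
  have h2 := (abs_le.mp h).2
  rw [min_eq_left (by norm_num)]
  norm_num at h2 ⊢
  linarith

/-- THE NUMBERS AT `d = 4` (ii): the rate condition `e^{ε + 2(log L∕R)d}·e^{−κ} < 1` at `L = 2`, `ε = 10⁻⁴`, `R = 10⁵`, `κ = 10⁻³`
(`log 2 ≤ 1`, `e^{−10⁻⁴} ≤ 1 − 10⁻⁴ + 10⁻⁸`). [folklore] -/
theorem rate_d4 : Real.exp ((1 / 10000 : ℝ) + 2 * (Real.log (2 : ℕ) / 100000) * ((4 : ℕ) : ℝ)) * Real.exp (-(1 / 1000 : ℝ)) < 1 := by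
  rw [← Real.exp_add]
  have hlog : Real.log (2 : ℕ) ≤ 1 := by
    have := Real.log_two_lt_d9
    push_cast
    linarith
  have hneg : (1 / 10000 : ℝ) + 2 * (Real.log (2 : ℕ) / 100000) * ((4 : ℕ) : ℝ) + -(1 / 1000 : ℝ) < 0 := by
    push_cast at hlog ⊢
    nlinarith
  exact Real.exp_lt_one_iff.2 hneg

/-- **RULE G-1, (E6)**: the decay row FIRES on the `d = 4` slot family (torus `4⁴`, `s = 1`, `L = 2`, ANY slot `Λ`, fibre `Unit`,
`c ≡ 1`, level coefficients `≡ 1`, `κ = 10⁻³`) at the FLAT background (E7 with `α ≡ 0`, `α₀ = 0`), full inverse (`χ ≡ 1`), for EVERY pair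
of cells — every hypothesis discharged. [folklore] -/
example (Λ : Finset (Ctr (fun _ : Fin 4 => 4) (2 * 1))) (cc b' : Cell 1 2 Λ) :=
  decayRow_dirInv_slot_of_plaquettes (Cp := Unit) (Λ := Λ) le_rfl (by norm_num) (fun _ => ⟨2, rfl⟩) (fun _ => oneM)
    (fun _ i j => oneM_orth i j) (acoef := fun _ => 1) (amin := 1) (amax := 1) zero_le_one (fun _ => le_rfl) (fun _ => le_rfl)
    (fun _ => 1) (cmin := 1) (cmax := 1) one_pos (fun _ => by simp) (fun _ => by simp) (fun _ => 0) (fun _ => le_rfl) (α₀ := 0)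
    (fun _ => by simp) (fun k v κ μ hκ hμ _ => norm_cellPlaq_flat_sub_one k v κ μ hκ hμ) (κ := 1 / 1000) (by norm_num) (by norm_num)
    mu0_pos_d4 (fun _ => 1) (fun _ => Or.inr rfl) cc b'

/-- **RULE G-1, (RS)**: the volume-free row sum FIRES on the same family (`s = 1 = 2⁰`, `ε = 10⁻⁴`, `R = 10⁵`, `κ = 10⁻³`) for EVERY cell.
[folklore] -/
example (Λ : Finset (Ctr (fun _ : Fin 4 => 4) (2 * 1))) (cc : Cell 1 2 Λ) :=
  rowSum_sdist_slot (Λ := Λ) le_rfl (by norm_num) (fun _ => ⟨2, rfl⟩) (j := 0) (by norm_num) (ε := 1 / 10000) (R := 100000)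
    (κ := 1 / 1000) (by norm_num) (by norm_num) (by norm_num) rate_d4 cc

/-- **RULE G-1, (E1)**: the bounded kernel operator FIRES on the same family at the flat background, full inverse — every hypothesis
discharged. [folklore] -/
example (Λ : Finset (Ctr (fun _ : Fin 4 => 4) (2 * 1))) :=
  opNorm_kerOp_dirInv_slot_of_plaquettes (Cp := Unit) (Λ := Λ) le_rfl (by norm_num) (fun _ => ⟨2, rfl⟩) (j := 0) (by norm_num)
    (fun _ => oneM) (fun _ i j => oneM_orth i j) (acoef := fun _ => 1) (amin := 1) (amax := 1) zero_le_one (fun _ => le_rfl)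
    (fun _ => le_rfl) (fun _ => 1) (cmin := 1) (cmax := 1) one_pos (fun _ => by simp) (fun _ => by simp) (fun _ => 0)
    (fun _ => le_rfl) (α₀ := 0) (fun _ => by simp) (fun k v κ μ hκ hμ _ => norm_cellPlaq_flat_sub_one k v κ μ hκ hμ)
    (κ := 1 / 1000) (by norm_num) (by norm_num) mu0_pos_d4 (ε := 1 / 10000) (R := 100000) (by norm_num) (by norm_num) rate_d4
    (fun _ => 1) (fun _ => Or.inr rfl)

end Summit.QuantumFields.BalabanUV.T4Continuum.ShellMeasureDecayRowsModelEnd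

end
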